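import Summits.BirchSwinnertonDyer.BirchSwinnertonDyer.Theorems.BiquadraticEisensteinDescentManinDatumSupercuspidalCMInertModelLValuesSexticOfDictionary
import Summits.BirchSwinnertonDyer.BirchSwinnertonDyer.Theorems.BiquadraticEisensteinDescentManinDatumSupercuspidalCMInertOfH5
import HarnessLib

set_option linter.dupNamespace false -- `Summit.BirchSwinnertonDyer.BirchSwinnertonDyer.Theorems.…` (summit = sub, D-0017)
set_option autoImplicit false

/-!
# Crux `ManinDatumSupercuspidalCMInert` (stmt-BirchSwinnertonDyer-20111, BED r605) BY NAME from the sextic theta dictionary alone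
# (width seat `bsd-wall-cm-bed-w3` g11; route cone through `…OfH5`; theorems only; `--supports 20111`, helper)

Route `BiquadraticEisensteinDescent` (cell `pub/bsd-wall`). One composition: bed-w3 g10's ★ `…OfH5.maninDatumSupercuspidalCMInert_of_H5`
(crux ⟸ `H₅`, p646963: the `j = 1728` half is the theorem `stub_S7`) ∘ this seat's ★ `…ModelLValuesSexticOfDictionary.H5_of_sexticDictionary`
(`H₅ ⟸ hdictAll`, p649222: CM core `core_rho_of_character` bed-w1 g8 + periods `exists_imaginaryPeriodRat_sextic` bed-w1 g8 + assembly D4 bed-w3 g11):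

* ★ `maninDatumSupercuspidalCMInert_of_sexticDictionary` — **`hdictAll → ManinDatumSupercuspidalCMInert`**, where `hdictAll` is the sextic
  theta DICTIONARY of the Mordell models `E^k : y² = x³ + k` (`5 ∣ k` sixth-power-free) packaged over the range of `H₅`: for each admissible
  `(k, ℓ, χ)` an exponent `e` with `|k| = 5^e k₁`, a modulus `M′` prime to `5`, the `5`-part `Φ : (ℤ/5)² → ℂ` with the five axioms of `(·/5)₆^e`,
  the prime-to-`5` weight `Ψ` modulo `M′` (algebraic-integer values), `W = Φ ⊗ Ψ` on `𝒪₃ = ℤω₃ + ℤ`, and an entire `L` with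
  `L(s) = Σ χ̄(n)a_n(E^k)n⁻ˢ` (`re s > 2`) and `L(1) = (u/N)·Θ-L_{3,2·5M′}(W♯)(1)` (`u ∈ ℤ̄`, `5 ∤ N`) — the announced output of bed-w2 g11's
  `Literature/…/SexticTwistThetaDictionary` (iii) (Ireland–Rosen Ch. 18 §7 for `y² = x³ + D` over `ℤ[ω]`, `5`-part split at the inert prime `5`).

READING for the planner: crux 20111 = `hdictAll` EXACTLY (kernel-checked); `hdictAll` is an E-side dictionary statement (no `L`-value
integrality, no CM input left). HONEST FRAMING: `hdictAll` is NOT proved here; the crux, its parent `ManinDatumFiveSevenCMInert`, Manin's conjecture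
and BSD are NOT proved by this. No definition, no named fact, no `sorry`; axioms standard.
-/

noncomputable section

open scoped Classical
open Complex PeriodPair
open Literature.NumberTheory.EllipticCurves
open Literature.NumberTheory.LFunctions
open Summit.BirchSwinnertonDyer.BirchSwinnertonDyer.Theses.BiquadraticEisensteinDescent

namespace Summit.BirchSwinnertonDyer.BirchSwinnertonDyer.Theorems.BiquadraticEisensteinDescentManinDatumSupercuspidalCMInertOfSexticDictionary

open Summit.BirchSwinnertonDyer.BirchSwinnertonDyer.Theorems.BiquadraticEisensteinDescentManinDatumSupercuspidalCMInertModelLValuesSexticOfDictionary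
  (H5_of_sexticDictionary)
open Summit.BirchSwinnertonDyer.BirchSwinnertonDyer.Theorems.BiquadraticEisensteinDescentManinDatumSupercuspidalCMInertOfH5
  (maninDatumSupercuspidalCMInert_of_H5)

/-- ★ **`hdictAll → ManinDatumSupercuspidalCMInert`** (crux 20111 BY NAME from the sextic theta dictionary of the Mordell models over `ℤ[ω]`,
packaged over the range of `H₅`; everything else — the `j = 1728` half `stub_S7`, the CM core at `5`, the periods, the CRT assembly — is a
tree theorem). [cite: IrelandRosen1990, Ch. 18 §7] [cite: Rubin1999, §7.4 Prop. 7.15] [cite: Manin1972, Thm. 1.6] -/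
theorem maninDatumSupercuspidalCMInert_of_sexticDictionary
    (hdictAll : ∀ (k : ℤ), k ≠ 0 → (5 : ℤ) ∣ k → (∀ q : ℕ, q.Prime → ¬ ((q : ℤ) ^ 6 ∣ k)) →
      ∀ (ℓ : ℕ) [NeZero ℓ], ℓ.Prime → 5 ≤ ℓ → ¬ (ℓ : ℤ) ∣ k → ¬ 4 ∣ ℓ - 1 → ¬ 5 ∣ ℓ - 1 →
        IsSquare ((5 : ℕ) : ZMod ℓ) →
      ∀ χ : DirichletCharacter ℂ ℓ, χ.Odd →
      ∃ (e k₁ M' : ℕ) (_ : NeZero M') (Φ : ZMod 5 × ZMod 5 → ℂ) (Ψ W : ℤ × ℤ → ℂ) (L : ℂ → ℂ) (u : ℂ) (N : ℕ),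
        1 ≤ e ∧ e ≤ 5 ∧ k.natAbs = 5 ^ e * k₁ ∧ Nat.Coprime 5 M' ∧
        Φ 0 = 0 ∧ Φ (0, 1) = 1 ∧ (∀ d, Φ (-d) = Φ d) ∧
        (∀ d : ZMod 5 × ZMod 5, Φ (d.2 - d.1, -d.1) = (UpperHalfPlane.ρ : ℂ) ^ e * Φ d) ∧
        (∀ d : ZMod 5 × ZMod 5, Φ (2 * d.1 - d.2, d.1 + d.2) = (-(UpperHalfPlane.ρ : ℂ) ^ 2) ^ e * Φ d) ∧
        (∀ y z : ℤ × ℤ, Ψ (y.1 + M' * z.1, y.2 + M' * z.2) = Ψ y) ∧ (∀ y : ℤ × ℤ, IsIntegral ℤ (Ψ y)) ∧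
        (∀ y : ℤ × ℤ, W y = Φ ((y.2 : ZMod 5), ((y.1 + y.2 : ℤ) : ZMod 5)) * Ψ y) ∧
        Differentiable ℂ L ∧
        (∀ s : ℂ, 2 < s.re →
          L s = LSeries (fun n : ℕ ↦ χ⁻¹ (n : ZMod ℓ) * ((⟨0, 0, 0, 0, (k : ℚ)⟩ : WeierstrassCurve ℚ).LFunction n : ℂ)) s) ∧
        IsIntegral ℤ u ∧ ¬ 5 ∣ N ∧
        L 1 = u / N * BinaryTheta.thetaLFunction 3 (2 * (5 * M')) 1 (-((Real.sqrt (3 : ℕ) : ℂ) * I))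
          (QuadOrder.parityLift W) 1) :
    ManinDatumSupercuspidalCMInert :=
  maninDatumSupercuspidalCMInert_of_H5 (H5_of_sexticDictionary hdictAll)

end Summit.BirchSwinnertonDyer.BirchSwinnertonDyer.Theorems.BiquadraticEisensteinDescentManinDatumSupercuspidalCMInertOfSexticDictionary

end
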